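import Summits.Ventures.HodgeRepro2.T5TensorSeparation

/-!
# T5SchurTensor — kernel witness for route/T5-CHECK-N3-p8.md v5 §9 Δ-N3.12-a (blind cell pub-hodge-repro2)

The «Schur ⇒ `1 ⊗ t`» step that both chains of local Howe-duality UNIQUENESS use:
* the archimedean chain, route/T5-N3-route-2.md v0.5 §N3.12.4 (s3) — «Φ̄ = 1_ρ ⊗ t with t : ρ′_1 → ρ′»
  from `End_{(𝔤,K)}(ρ) = ℂ`, before Howe 1989 Theorem 2.1 is invoked;
* the p-adic chain, Mœglin–Vignéras–Waldspurger LNM 1291 chap. 2 Lemma III.3 / III.4, as read in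
  CHECK-N3 v3 §7 row N3.10.3 («a map V₁ ⊗ V₂′ → V₁ ⊗ V₂ is id ⊗ g»).

Kernel form (same conventions as `T5TensorSeparation`): `k` the coefficient field, `S` a `k`-algebra
(the group algebra / enveloping algebra of the first member in the prose), `M` an `S`-module
(ρ, resp. V₁) ALL OF WHOSE `S`-ENDOMORPHISMS ARE `k`-SCALARS (Schur's lemma for ρ — a hypothesis here),
`A`, `B` `k`-vector spaces (ρ′_1 and ρ′, resp. V₂′ and V₂) on which `S` does not act; `S` acts on
`M ⊗[k] A` and `M ⊗[k] B` through `M`.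
* `exists_fun`: every `S`-linear `Φ : M ⊗[k] A →ₗ[S] M ⊗[k] B` satisfies `Φ (m ⊗ a) = m ⊗ t a` for
  some function `t : A → B` (the coordinate maps of `T5TensorSeparation` turn `m ↦ Φ (m ⊗ a)` into
  `S`-endomorphisms of `M`, hence scalars `C a j`; `t a` is the vector with these coordinates).
* `tmul_right_injective'`: for `m₀ ≠ 0`, `m₀ ⊗ b₁ = m₀ ⊗ b₂ → b₁ = b₂`.
* `exists_linear`: hence `t` is unique and `k`-linear — `Φ = 1_M ⊗ t` for a unique `t : A →ₗ[k] B`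
  (`linear_unique`).
Nothing about representations is asserted: (𝔤,K)-modules, admissibility (which is what makes Schur
hold in the prose) and the Weil representation stay in the prose.
-/

namespace Summit.Ventures.HodgeRepro2.T5SchurTensor

open TensorProduct Summit.Ventures.HodgeRepro2.T5TensorSeparation

variable {k S : Type*} [Field k] [Ring S] [Algebra k S]
variable {M : Type*} [AddCommGroup M] [Module k M] [Module S M] [IsScalarTower k S M]
variable {A B : Type*} [AddCommGroup A] [Module k A] [AddCommGroup B] [Module k B]

/-- The `S`-linear map `m ↦ m ⊗ a` (`S` acts on `M ⊗[k] A` through `M`). -/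
def tmulRight (a : A) : M →ₗ[S] M ⊗[k] A where
  toFun m := m ⊗ₜ[k] a
  map_add' m₁ m₂ := TensorProduct.add_tmul m₁ m₂ a
  map_smul' s m := (TensorProduct.smul_tmul' s m a).symm

/-- `tmulRight a m = m ⊗ a`. -/
@[simp]
theorem tmulRight_apply (a : A) (m : M) : tmulRight (S := S) (k := k) a m = m ⊗ₜ[k] a := rfl

/-- The coordinate equivalence `M ⊗[k] B ≃ₗ[S] (κ →₀ M)` of a basis `c` of `B`; its `j`-th
coordinate is `coordMap c j`. -/
noncomputable def coordEquiv {κ : Type*} [DecidableEq κ] (c : Module.Basis κ k B) :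
    M ⊗[k] B ≃ₗ[S] (κ →₀ M) :=
  (AlgebraTensorModule.congr (LinearEquiv.refl S M) c.repr).trans (finsuppScalarRight k S M κ)

/-- The `j`-th coordinate of `coordEquiv c` is `coordMap c j`. -/
theorem coordEquiv_apply {κ : Type*} [DecidableEq κ] (c : Module.Basis κ k B) (x : M ⊗[k] B)
    (j : κ) : coordEquiv (S := S) c x j = coordMap (S := S) c j x := rfl

/-- For `m₀ ≠ 0`, `b ↦ m₀ ⊗ b` is injective (compare coordinates). -/
theorem tmul_right_injective' {m₀ : M} (hm₀ : m₀ ≠ 0) {b₁ b₂ : B}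
    (h : m₀ ⊗ₜ[k] b₁ = m₀ ⊗ₜ[k] b₂) : b₁ = b₂ := by
  classical
  let c := Module.Free.chooseBasis k B
  apply c.repr.injective
  ext j
  have h' : c.repr b₁ j • m₀ = c.repr b₂ j • m₀ := by
    have := congrArg (coordMap (S := k) c j) h
    simpa only [coordMap_tmul] using this
  exact smul_left_injective k hm₀ h'

/-- Step 1: `Φ (m ⊗ a) = m ⊗ t a` for SOME function `t`, when every `S`-endomorphism of `M` is a
`k`-scalar. -/
theorem exists_fun (hS : ∀ φ : M →ₗ[S] M, ∃ c : k, ∀ x, φ x = c • x)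
    (Φ : M ⊗[k] A →ₗ[S] M ⊗[k] B) :
    ∃ t : A → B, ∀ (m : M) (a : A), Φ (m ⊗ₜ[k] a) = m ⊗ₜ[k] t a := by
  classical
  by_cases hM : Subsingleton M
  · refine ⟨fun _ => 0, fun m a => ?_⟩
    rw [Subsingleton.elim m 0]
    simp
  have hnt : Nontrivial M := not_subsingleton_iff_nontrivial.mp hM
  obtain ⟨m₀, hm₀⟩ := exists_ne (0 : M)
  let c := Module.Free.chooseBasis k B
  -- the scalar of the `S`-endomorphism `m ↦ coordMap c j (Φ (m ⊗ a))`
  have key : ∀ (a : A) (j : Module.Free.ChooseBasisIndex k B), ∃ C : k,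
      ∀ m : M, coordMap (S := S) c j (Φ (m ⊗ₜ[k] a)) = C • m := fun a j =>
    hS ((coordMap (S := S) c j) ∘ₗ Φ ∘ₗ tmulRight a)
  choose C hC using key
  -- the scalars have finite support in `j` (they are the coordinates of `Φ (m₀ ⊗ a)`)
  have hsupp : ∀ a j, C a j ≠ 0 → j ∈ (coordEquiv (S := S) c (Φ (m₀ ⊗ₜ[k] a))).support := by
    intro a j hj
    rw [Finsupp.mem_support_iff, coordEquiv_apply, hC a j m₀]
    exact smul_ne_zero hj hm₀
  refine ⟨fun a => c.repr.symm (Finsupp.onFinset _ (fun j => C a j) (hsupp a)), ?_⟩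
  intro m a
  apply (coordEquiv (S := S) c).injective
  ext j
  rw [coordEquiv_apply, coordEquiv_apply, hC a j m, coordMap_tmul, LinearEquiv.apply_symm_apply,
    Finsupp.onFinset_apply]

/-- Step 2: for a non-trivial `M` the function `t` is unique and `k`-linear: `Φ = 1_M ⊗ t` for a
unique linear `t : A →ₗ[k] B`. -/
theorem exists_linear [Nontrivial M] (hS : ∀ φ : M →ₗ[S] M, ∃ c : k, ∀ x, φ x = c • x)
    (Φ : M ⊗[k] A →ₗ[S] M ⊗[k] B) :
    ∃ t : A →ₗ[k] B, ∀ (m : M) (a : A), Φ (m ⊗ₜ[k] a) = m ⊗ₜ[k] t a := by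
  obtain ⟨t, ht⟩ := exists_fun hS Φ
  obtain ⟨m₀, hm₀⟩ := exists_ne (0 : M)
  refine ⟨{ toFun := t, map_add' := ?_, map_smul' := ?_ }, ht⟩
  · intro a₁ a₂
    apply tmul_right_injective' (k := k) hm₀
    rw [← ht, TensorProduct.tmul_add, map_add, ht, ht, ← TensorProduct.tmul_add]
  · intro r a
    apply tmul_right_injective' (k := k) hm₀
    rw [RingHom.id_apply, ← ht, TensorProduct.tmul_smul, TensorProduct.tmul_smul,
      ← algebraMap_smul S r (m₀ ⊗ₜ[k] a), map_smul, algebraMap_smul, ht]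

/-- Uniqueness of `t` (for `M ≠ 0`). -/
theorem linear_unique [Nontrivial M] (Φ : M ⊗[k] A →ₗ[S] M ⊗[k] B) {t₁ t₂ : A →ₗ[k] B}
    (h₁ : ∀ (m : M) (a : A), Φ (m ⊗ₜ[k] a) = m ⊗ₜ[k] t₁ a)
    (h₂ : ∀ (m : M) (a : A), Φ (m ⊗ₜ[k] a) = m ⊗ₜ[k] t₂ a) : t₁ = t₂ := by
  obtain ⟨m₀, hm₀⟩ := exists_ne (0 : M)
  ext a
  exact tmul_right_injective' hm₀ ((h₁ m₀ a).symm.trans (h₂ m₀ a))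

end Summit.Ventures.HodgeRepro2.T5SchurTensor
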